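import Mathlib.Algebra.MvPolynomial.Supported
import Literature.Computability.AlgebraicComplexity.FormulaUnfolding
import HarnessLib

/-!
# Syntactically multilinear formulas as trees, and the one-level product decomposition
(Raz 2006 §2–§3; Shpilka–Yehudayoff-style "log-product" route to the multilinear formula lower
bound)

Support file for the partial-derivative-matrix method (`FullRankMultilinear*.lean`), step (a1)–(a2)
of the roadmap to Raz's `n^{Ω(log n)}` lower bound for multilinear formulas [Raz2006, Cor. 3.6]
in the form needed by the natural-proofs packaging
(`Summits/…/BarrierLeverDefinableEquationsFullRankMethod.lean`): every small syntactically
multilinear formula computes a rank-deficient polynomial for SOME balanced partition.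

Formulas are the tree type `WExpr` of `FormulaUnfolding.lean` (fan-in-two weighted sums and
products; bridge `exists_wexpr_iff_formulaComplexity_le`).  Here:

* `varSet e` — the set `X_v` of variables occurring in the (sub)formula [Raz2006, §2];
  `IsSyntMultilinear e` — "for every product gate `v` with children `v₁, v₂`, the sets `X_{v₁}`
  and `X_{v₂}` are disjoint" [Raz2006, §2]; `eval_mem_supported` (`Φ_v ∈ K[X_v]`).
* `decomp t e` — the ONE-LEVEL DECOMPOSITION at threshold `t`: a list of triples `(g, A, V)` with
  `e.eval = Σ g.eval · A` (`sum_decomp`), at most `e.size + 1` terms (`length_decomp_le`), and for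
  syntactically multilinear `e` and `t ≥ 1` (`decomp_spec`): `g` is a syntactically multilinear
  sub-formula with `varSet g ⊆ varSet e` and `|varSet g| ≤ 2t`, the cofactor `A` is a polynomial
  in the variables `V ⊆ varSet e`, `V ∩ varSet g = ∅`, and EITHER `t < |varSet g|` (a GOOD term:
  the node `v` with `t < |X_v| ≤ 2t` reached by descending to the larger child, `A` = the product
  of the smaller siblings met on the way) OR `|varSet g| + |V| + t < |varSet e|` (a REMAINDER term,
  born at a large sum gate: it leaves more than `t` variables of `e` uncovered, hence has rank
  `≤ 2^{(|X|-t)/2}` under every cut and never matters).  This is the mechanism of Raz's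
  "central paths" / of the survey decomposition `Φ = Σ_i g_i h_i`, `|X(g_i)| ∈ (t, 2t]`
  [Raz2006, §3.2; cf. Shpilka–Yehudayoff, Found. Trends TCS 5 (2010), §3.6].

What is NOT here: the iteration to log-products (roadmap (a3)) and the counting assembly ((a4));
the bricks for those are `FullRankMultilinearProductRank.lean` and
`FullRankMultilinearCutCounting.lean`.

## References
* [Raz2006] R. Raz, *Separation of multilinear circuit and formula size*, Theory of Computing 2
  (2006) 121–135, §2 (syntactic multilinear formulas, Prop. 2.1), §3.2 (unbalanced nodes,
  central paths), Lemma 3.3, Cor. 3.6.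
-/

noncomputable section

namespace Literature.Barriers.ValiantsHypothesis.RazFormula

open MvPolynomial Finset Literature.Computability.AlgebraicComplexity
open Literature.Computability.AlgebraicComplexity.WExpr

universe u v

variable {k : Type u} {σ : Type v} [DecidableEq σ]

/-! ### Variable sets and syntactic multilinearity -/

/-- The set `X_v` of variables occurring in a formula (its variable leaves). [cite: Raz2006, §2] -/
def varSet : WExpr k σ → Finset σ
  | .var i => {i}
  | .const _ => ∅
  | .lin _ e₁ _ e₂ => varSet e₁ ∪ varSet e₂
  | .mul e₁ e₂ => varSet e₁ ∪ varSet e₂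

/-- Unfolding of `varSet` on a variable. [cite: Raz2006, §2] -/
@[simp] theorem varSet_var (i : σ) : varSet (.var i : WExpr k σ) = {i} := rfl
/-- Unfolding of `varSet` on a constant. [cite: Raz2006, §2] -/
@[simp] theorem varSet_const (c : k) : varSet (.const c : WExpr k σ) = ∅ := rfl
/-- Unfolding of `varSet` on a sum node. [cite: Raz2006, §2] -/
@[simp] theorem varSet_lin (c₁ : k) (e₁ : WExpr k σ) (c₂ : k) (e₂ : WExpr k σ) :
    varSet (.lin c₁ e₁ c₂ e₂) = varSet e₁ ∪ varSet e₂ := rfl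
/-- Unfolding of `varSet` on a product node. [cite: Raz2006, §2] -/
@[simp] theorem varSet_mul (e₁ e₂ : WExpr k σ) : varSet (.mul e₁ e₂) = varSet e₁ ∪ varSet e₂ := rfl

/-- **Syntactically multilinear formula**: the two children of every product node have disjoint
variable sets. [cite: Raz2006, §2] -/
def IsSyntMultilinear : WExpr k σ → Prop
  | .var _ => True
  | .const _ => True
  | .lin _ e₁ _ e₂ => IsSyntMultilinear e₁ ∧ IsSyntMultilinear e₂
  | .mul e₁ e₂ => IsSyntMultilinear e₁ ∧ IsSyntMultilinear e₂ ∧ Disjoint (varSet e₁) (varSet e₂)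

/-- Unfolding on a sum node. [cite: Raz2006, §2] -/
@[simp] theorem isSyntMultilinear_lin (c₁ : k) (e₁ : WExpr k σ) (c₂ : k) (e₂ : WExpr k σ) :
    IsSyntMultilinear (.lin c₁ e₁ c₂ e₂) ↔ IsSyntMultilinear e₁ ∧ IsSyntMultilinear e₂ := Iff.rfl
/-- Unfolding on a product node. [cite: Raz2006, §2] -/
@[simp] theorem isSyntMultilinear_mul (e₁ e₂ : WExpr k σ) :
    IsSyntMultilinear (.mul e₁ e₂) ↔
      IsSyntMultilinear e₁ ∧ IsSyntMultilinear e₂ ∧ Disjoint (varSet e₁) (varSet e₂) := Iff.rfl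
/-- Leaves are syntactically multilinear. [cite: Raz2006, §2] -/
@[simp] theorem isSyntMultilinear_var (i : σ) : IsSyntMultilinear (.var i : WExpr k σ) := trivial
/-- Constants are syntactically multilinear. [cite: Raz2006, §2] -/
@[simp] theorem isSyntMultilinear_const (c : k) : IsSyntMultilinear (.const c : WExpr k σ) := trivial

variable [CommSemiring k]

/-- `Φ_v ∈ K[X_v]`: a formula computes a polynomial in its own variables. [cite: Raz2006, §2] -/
theorem eval_mem_supported (e : WExpr k σ) : e.eval ∈ supported k (↑(varSet e) : Set σ) := by
  induction e with
  | var i =>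
    rw [eval_var, supported_eq_adjoin_X]
    exact Algebra.subset_adjoin ⟨i, by simp, rfl⟩
  | const c => exact Subalgebra.algebraMap_mem _ c
  | lin c₁ e₁ c₂ e₂ ih₁ ih₂ =>
    rw [eval_lin, varSet_lin]
    refine Subalgebra.add_mem _ (Subalgebra.smul_mem _ (supported_mono ?_ ih₁) c₁)
      (Subalgebra.smul_mem _ (supported_mono ?_ ih₂) c₂)
    · exact_mod_cast Finset.subset_union_left
    · exact_mod_cast Finset.subset_union_right
  | mul e₁ e₂ ih₁ ih₂ =>
    rw [WExpr.eval_mul, varSet_mul]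
    refine Subalgebra.mul_mem _ (supported_mono ?_ ih₁) (supported_mono ?_ ih₂)
    · exact_mod_cast Finset.subset_union_left
    · exact_mod_cast Finset.subset_union_right

/-! ### The one-level decomposition -/

/-- **One-level decomposition at threshold `t`** (descend to the larger child through large
nodes; split large sums; at a large product keep the smaller sibling as a cofactor): a list of
triples `(g, A, V)` — sub-formula, cofactor, declared variables of the cofactor. [cite: Raz2006, §3.2] -/
def decomp (t : ℕ) : WExpr k σ → List (WExpr k σ × MvPolynomial σ k × Finset σ)
  | .var i => [(.var i, 1, ∅)]
  | .const c => [(.const c, 1, ∅)]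
  | .lin c₁ e₁ c₂ e₂ =>
      if (varSet e₁ ∪ varSet e₂).card ≤ 2 * t then [(.lin c₁ e₁ c₂ e₂, 1, ∅)]
      else (decomp t e₁).map (fun p => (p.1, c₁ • p.2.1, p.2.2)) ++
        (decomp t e₂).map (fun p => (p.1, c₂ • p.2.1, p.2.2))
  | .mul e₁ e₂ =>
      if (varSet e₁ ∪ varSet e₂).card ≤ 2 * t then [(.mul e₁ e₂, 1, ∅)]
      else if (varSet e₂).card ≤ (varSet e₁).card then
        (decomp t e₁).map (fun p => (p.1, p.2.1 * e₂.eval, p.2.2 ∪ varSet e₂))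
      else (decomp t e₂).map (fun p => (p.1, p.2.1 * e₁.eval, p.2.2 ∪ varSet e₁))

/-- **The decomposition computes the formula**: `e.eval = Σ_{(g, A, V)} g.eval · A`.
[cite: Raz2006, §3.2] -/
theorem sum_decomp (t : ℕ) (e : WExpr k σ) :
    ((decomp t e).map fun p => p.1.eval * p.2.1).sum = e.eval := by
  induction e with
  | var i => simp [decomp]
  | const c => simp [decomp]
  | lin c₁ e₁ c₂ e₂ ih₁ ih₂ =>
    simp only [decomp]
    split_ifs with h
    · simp
    · rw [List.map_append, List.sum_append, List.map_map, List.map_map, eval_lin]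
      have h1 : ((decomp t e₁).map ((fun p => p.1.eval * p.2.1) ∘ fun p => (p.1, c₁ • p.2.1, p.2.2))).sum
          = c₁ • ((decomp t e₁).map fun p => p.1.eval * p.2.1).sum := by
        rw [List.smul_sum, List.map_map]
        congr 1
        refine List.map_congr_left fun p _ => ?_
        simp only [Function.comp_apply, mul_smul_comm]
      have h2 : ((decomp t e₂).map ((fun p => p.1.eval * p.2.1) ∘ fun p => (p.1, c₂ • p.2.1, p.2.2))).sum
          = c₂ • ((decomp t e₂).map fun p => p.1.eval * p.2.1).sum := by
        rw [List.smul_sum, List.map_map]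
        congr 1
        refine List.map_congr_left fun p _ => ?_
        simp only [Function.comp_apply, mul_smul_comm]
      rw [h1, h2, ih₁, ih₂]
  | mul e₁ e₂ ih₁ ih₂ =>
    simp only [decomp]
    split_ifs with h h'
    · simp
    · rw [List.map_map, WExpr.eval_mul, ← ih₁, ← List.sum_map_mul_right]
      congr 1
      refine List.map_congr_left fun p _ => ?_
      simp only [Function.comp_apply, mul_assoc]
    · rw [List.map_map, WExpr.eval_mul, ← ih₂, mul_comm, ← List.sum_map_mul_right]
      congr 1
      refine List.map_congr_left fun p _ => ?_
      simp only [Function.comp_apply, mul_assoc]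

/-- **At most `|Φ| + 1` terms.** [cite: Raz2006, §3.2] -/
theorem length_decomp_le (t : ℕ) (e : WExpr k σ) : (decomp t e).length ≤ e.size + 1 := by
  induction e with
  | var i => simp [decomp]
  | const c => simp [decomp]
  | lin c₁ e₁ c₂ e₂ ih₁ ih₂ =>
    simp only [decomp]
    split_ifs
    · simp
    · rw [List.length_append, List.length_map, List.length_map, size_lin]; omega
  | mul e₁ e₂ ih₁ ih₂ =>
    simp only [decomp]
    split_ifs
    · simp
    · rw [List.length_map, size_mul]; omega
    · rw [List.length_map, size_mul]; omega

/-- A small formula (`|varSet e| ≤ 2t`) is its own single term. [cite: Raz2006, §3.2] -/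
theorem decomp_of_card_le {t : ℕ} {e : WExpr k σ} (h : (varSet e).card ≤ 2 * t) :
    decomp t e = [(e, 1, ∅)] := by
  cases e with
  | var i => rfl
  | const c => rfl
  | lin c₁ e₁ c₂ e₂ => rw [varSet_lin] at h; simp [decomp, h]
  | mul e₁ e₂ => rw [varSet_mul] at h; simp [decomp, h]

/-- **Specification of the terms** (for a syntactically multilinear `e` with `|varSet e| > 2t`,
`t ≥ 1`): every `(g, A, V) ∈ decomp t e` has `g` syntactically multilinear, `varSet g ⊆ varSet e`,
`|varSet g| ≤ 2t`, `A ∈ K[V]`, `V ⊆ varSet e`, `V ∩ varSet g = ∅`, and is either GOOD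
(`t < |varSet g|`) or a REMAINDER (`|varSet g| + |V| + t < |varSet e|`: more than `t` variables of
`e` are uncovered by the term). [cite: Raz2006, §3.2] -/
theorem decomp_spec {t : ℕ} (ht : 1 ≤ t) :
    ∀ {e : WExpr k σ}, IsSyntMultilinear e → 2 * t < (varSet e).card →
      ∀ {g : WExpr k σ} {A : MvPolynomial σ k} {V : Finset σ}, (g, A, V) ∈ decomp t e →
        IsSyntMultilinear g ∧ varSet g ⊆ varSet e ∧ (varSet g).card ≤ 2 * t ∧
          A ∈ supported k (↑V : Set σ) ∧ V ⊆ varSet e ∧ Disjoint V (varSet g) ∧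
          (t < (varSet g).card ∨ (varSet g).card + V.card + t < (varSet e).card) := by
  intro e
  induction e with
  | var i => intro _ hlarge; rw [varSet_var, card_singleton] at hlarge; omega
  | const c => intro _ hlarge; rw [varSet_const, card_empty] at hlarge; omega
  | lin c₁ e₁ c₂ e₂ ih₁ ih₂ =>
    intro he hlarge g A V hp
    rw [isSyntMultilinear_lin] at he
    rw [varSet_lin] at hlarge ⊢
    simp only [decomp] at hp
    rw [if_neg (not_le.2 hlarge), List.mem_append, List.mem_map, List.mem_map] at hp
    have hu₁ : (varSet e₁).card ≤ (varSet e₁ ∪ varSet e₂).card := card_le_card subset_union_left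
    have hu₂ : (varSet e₂).card ≤ (varSet e₁ ∪ varSet e₂).card := card_le_card subset_union_right
    rcases hp with ⟨⟨g', A', V'⟩, hmem, hEq⟩ | ⟨⟨g', A', V'⟩, hmem, hEq⟩
    · simp only [Prod.mk.injEq] at hEq
      obtain ⟨rfl, rfl, rfl⟩ := hEq
      by_cases h1 : 2 * t < (varSet e₁).card
      · obtain ⟨hg, hsub, hcard, hA, hV, hdisj, hdich⟩ := ih₁ he.1 h1 hmem
        refine ⟨hg, hsub.trans subset_union_left, hcard, Subalgebra.smul_mem _ hA c₁,
          hV.trans subset_union_left, hdisj, ?_⟩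
        rcases hdich with h | h
        · exact Or.inl h
        · exact Or.inr (by omega)
      · have hc1 : (varSet e₁).card ≤ 2 * t := not_lt.1 h1
        rw [decomp_of_card_le hc1, List.mem_singleton, Prod.mk.injEq] at hmem
        rcases lt_or_ge t (varSet e₁).card with h2 | h2
        · obtain ⟨rfl, rfl, rfl⟩ := hmem
          exact ⟨he.1, subset_union_left, hc1, Subalgebra.smul_mem _ (Subalgebra.one_mem _) c₁,
            empty_subset _, disjoint_empty_left _, Or.inl h2⟩
        · obtain ⟨rfl, rfl, rfl⟩ := hmem
          refine ⟨he.1, subset_union_left, hc1, Subalgebra.smul_mem _ (Subalgebra.one_mem _) c₁,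
            empty_subset _, disjoint_empty_left _, Or.inr ?_⟩
          rw [card_empty]; omega
    · simp only [Prod.mk.injEq] at hEq
      obtain ⟨rfl, rfl, rfl⟩ := hEq
      by_cases h1 : 2 * t < (varSet e₂).card
      · obtain ⟨hg, hsub, hcard, hA, hV, hdisj, hdich⟩ := ih₂ he.2 h1 hmem
        refine ⟨hg, hsub.trans subset_union_right, hcard, Subalgebra.smul_mem _ hA c₂,
          hV.trans subset_union_right, hdisj, ?_⟩
        rcases hdich with h | h
        · exact Or.inl h
        · exact Or.inr (by omega)
      · have hc2 : (varSet e₂).card ≤ 2 * t := not_lt.1 h1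
        rw [decomp_of_card_le hc2, List.mem_singleton, Prod.mk.injEq] at hmem
        rcases lt_or_ge t (varSet e₂).card with h2 | h2
        · obtain ⟨rfl, rfl, rfl⟩ := hmem
          exact ⟨he.2, subset_union_right, hc2, Subalgebra.smul_mem _ (Subalgebra.one_mem _) c₂,
            empty_subset _, disjoint_empty_left _, Or.inl h2⟩
        · obtain ⟨rfl, rfl, rfl⟩ := hmem
          refine ⟨he.2, subset_union_right, hc2, Subalgebra.smul_mem _ (Subalgebra.one_mem _) c₂,
            empty_subset _, disjoint_empty_left _, Or.inr ?_⟩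
          rw [card_empty]; omega
  | mul e₁ e₂ ih₁ ih₂ =>
    intro he hlarge g A V hp
    rw [isSyntMultilinear_mul] at he
    rw [varSet_mul] at hlarge ⊢
    have hcu : (varSet e₁ ∪ varSet e₂).card = (varSet e₁).card + (varSet e₂).card :=
      card_union_of_disjoint he.2.2
    simp only [decomp] at hp
    rw [if_neg (not_le.2 hlarge)] at hp
    by_cases h12 : (varSet e₂).card ≤ (varSet e₁).card
    · rw [if_pos h12, List.mem_map] at hp
      obtain ⟨⟨g', A', V'⟩, hmem, hEq⟩ := hp
      simp only [Prod.mk.injEq] at hEq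
      obtain ⟨rfl, rfl, rfl⟩ := hEq
      have h1t : t < (varSet e₁).card := by omega
      by_cases h1 : 2 * t < (varSet e₁).card
      · obtain ⟨hg, hsub, hcard, hA, hV, hdisj, hdich⟩ := ih₁ he.1 h1 hmem
        refine ⟨hg, hsub.trans subset_union_left, hcard, ?_, ?_, ?_, ?_⟩
        · refine Subalgebra.mul_mem _ (supported_mono ?_ hA) (supported_mono ?_ (eval_mem_supported e₂))
          · exact_mod_cast subset_union_left
          · exact_mod_cast subset_union_right
        · exact union_subset (hV.trans subset_union_left) subset_union_right
        · exact disjoint_union_left.2 ⟨hdisj, he.2.2.symm.mono_right hsub⟩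
        · rcases hdich with h | h
          · exact Or.inl h
          · right
            have := card_union_le V' (varSet e₂)
            omega
      · rw [decomp_of_card_le (not_lt.1 h1), List.mem_singleton, Prod.mk.injEq] at hmem
        obtain ⟨rfl, rfl, rfl⟩ := hmem
        refine ⟨he.1, subset_union_left, not_lt.1 h1, ?_, ?_, ?_, Or.inl h1t⟩
        · rw [one_mul]
          exact supported_mono (by exact_mod_cast subset_union_right) (eval_mem_supported e₂)
        · exact union_subset (empty_subset _) subset_union_right
        · rw [empty_union]; exact he.2.2.symm
    · rw [if_neg h12, List.mem_map] at hp
      obtain ⟨⟨g', A', V'⟩, hmem, hEq⟩ := hp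
      simp only [Prod.mk.injEq] at hEq
      obtain ⟨rfl, rfl, rfl⟩ := hEq
      have h2t : t < (varSet e₂).card := by omega
      by_cases h1 : 2 * t < (varSet e₂).card
      · obtain ⟨hg, hsub, hcard, hA, hV, hdisj, hdich⟩ := ih₂ he.2.1 h1 hmem
        refine ⟨hg, hsub.trans subset_union_right, hcard, ?_, ?_, ?_, ?_⟩
        · refine Subalgebra.mul_mem _ (supported_mono ?_ hA) (supported_mono ?_ (eval_mem_supported e₁))
          · exact_mod_cast subset_union_left
          · exact_mod_cast subset_union_right
        · exact union_subset (hV.trans subset_union_right) subset_union_left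
        · exact disjoint_union_left.2 ⟨hdisj, he.2.2.mono_right hsub⟩
        · rcases hdich with h | h
          · exact Or.inl h
          · right
            have := card_union_le V' (varSet e₁)
            omega
      · rw [decomp_of_card_le (not_lt.1 h1), List.mem_singleton, Prod.mk.injEq] at hmem
        obtain ⟨rfl, rfl, rfl⟩ := hmem
        refine ⟨he.2.1, subset_union_right, not_lt.1 h1, ?_, ?_, ?_, Or.inl h2t⟩
        · rw [one_mul]
          exact supported_mono (by exact_mod_cast subset_union_right) (eval_mem_supported e₁)
        · exact union_subset (empty_subset _) subset_union_left
        · rw [empty_union]; exact he.2.2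

end Literature.Barriers.ValiantsHypothesis.RazFormula
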